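import Summits.Ventures.CertifiedArithmetic.LowPrec.OptStreaming
import Summits.Ventures.CertifiedArithmetic.LowPrec.OptRegisters

/-!
# OptStreamingOpt — Theorem T6(b): the streaming optimum `OPT_D2 = B5` under `(m-1)(1+qu)v ≤ u`, attainment, erratum

HONEST FRAMING: certified error envelopes and provably optimal rounding/accumulation schemes for
low-precision formats under stated cost models; every table by two implementations; no hardware or
vendor claims.

Continuation of `OptStreaming` (cost model CM-B, family D2 = streaming two-precision summation):
* `B5_le_streamV` — under `(m-1)·(1+q·u)·v ≤ u` every composition of `n = qm + r` into `m` positive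
  blocks has streaming polynomial `V ≥ B5`;
* `streamV_mostEqual` — the most-equal blocks in nondecreasing order attain `B5` (for `r = 0` always, for
  `r ≥ 1` whenever `(m-r-1)·v·S ≤ u`, which the condition implies): `OPT_D2(n,m) = B5`;
* `treeMP_streamDesign` — the streaming polynomial IS the node-weighted tree polynomial (Theorem T5) of
  the streaming design, so `1 - 1/B5` is the exact worst-case relative under-estimation of the best
  streaming scheme with `m - 1` wide additions (nonnegative data, round-to-nearest, ties to even);
* `erratum_T5e_D2` — the generation-5 text asserted the closed form under `(m-1)·v ≤ u`; FALSE: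
  `u = 2⁻⁴, v = 2⁻⁸, n = 74, m = 15` satisfies it and the composition `(4,4,5,…,5,6)` beats `B5`
  (so most-equal blocks are not optimal there).  Under the corrected condition no counterexample exists
  (this file), and none was found where only the old one holds for `(p_lo,p_hi) ∈ {(8,24),(11,24),(4,11),
  (8,11),(5,11)}`, `n ≤ 100` (certificate C17; 34 / 55 / 14 counterexample cells for (4,8) / (3,8) / (5,8)).
* `R4_StreamingOptimum` (+ `_holds`) — Statement-style summary.
-/

namespace Summit.Ventures.CertifiedArithmetic.LowPrec.Opt

open Literature.ComputerArithmetic.JeannerodRump2018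
open Literature.ComputerArithmetic.JeannerodRump2018.SumTree
open PTree DTree

/-! ## The conditional lower bound -/

/-- A list of positive naturals has `length ≤ sum`. -/
theorem length_le_sum_of_one_le : ∀ l : List ℕ, (∀ b ∈ l, 1 ≤ b) → l.length ≤ l.sum
  | [], _ => by simp
  | b :: l, h => by
      rw [List.sum_cons, List.length_cons]
      have := h b (by simp)
      have := length_le_sum_of_one_le l (fun c hc => h c (by simp [hc]))
      omega

/-- T6(b) LOWER BOUND: under `(m-1)(1+qu)v ≤ u`, every composition of `qm + r` into `m` positive blocks
has streaming polynomial at least `B5`. -/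
theorem B5_le_streamV {u v : ℚ} (hu0 : 0 ≤ u) (hu1 : u ≤ 1) (hv0 : 0 ≤ v) (hv1 : v ≤ 1)
    {q r : ℕ} {blocks : List ℕ} (hq : 1 ≤ q) (hrm : r < blocks.length)
    (hsum : blocks.sum = q * blocks.length + r)
    (hcond : ((blocks.length : ℚ) - 1) * (1 + (q : ℚ) * u) * v ≤ u) :
    B5 u v q r blocks.length ≤ streamV u v blocks := by
  have h3 := B5_le_of_cond hu0 hv0 hv1 hq hrm hcond
  rcases Nat.eq_zero_or_pos r with hr | hr
  · subst hr
    rw [if_pos rfl] at h3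
    by_cases hbig : ∃ b ∈ blocks, q + 1 ≤ b
    · obtain ⟨b, hb, hqb⟩ := hbig
      have h1 : bval u b ≤ streamV u v blocks := bval_le_streamV hu0 hu1 hv0 hb
      have h2 : bval u (q + 1) ≤ bval u b := bval_mono hu0 hqb
      have h4 : bval u (q + 1) = 1 + ((q : ℚ) - 1) * u + u := by unfold bval; push_cast; ring
      linarith
    · have hle : ∀ b ∈ blocks, b ≤ q := fun b hb => by
        by_contra h; exact hbig ⟨b, hb, by omega⟩
      have hall := forall_eq_of_sum_eq blocks hle (by simpa using hsum)
      obtain ⟨k, hk⟩ : ∃ k, blocks.length = k + 1 := ⟨blocks.length - 1, by omega⟩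
      have hrep : blocks = List.replicate (k + 1) q := by
        rw [← hk]; exact List.eq_replicate_iff.mpr ⟨rfl, hall⟩
      have hS0 : 0 ≤ bval u q := bval_nonneg hu0 hu1 q
      rw [hrep, List.replicate_succ, streamV_cons hu0 hu1, List.map_replicate,
        sfold_replicate hv0 hS0 k le_rfl, List.length_cons, List.length_replicate]
      unfold B5 bval; rw [if_pos rfl]; push_cast; nlinarith
  · rw [if_neg (by omega)] at h3
    by_cases hbig : ∃ b ∈ blocks, q + 2 ≤ b
    · obtain ⟨b, hb, hqb⟩ := hbig
      have h1 : bval u b ≤ streamV u v blocks := bval_le_streamV hu0 hu1 hv0 hb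
      have h2 : bval u (q + 2) ≤ bval u b := bval_mono hu0 hqb
      have h4 : bval u (q + 2) = 1 + (q : ℚ) * u + u := by unfold bval; push_cast; ring
      linarith
    · exact B5_le_streamV_of_le_succ hu0 hu1 hv0 hv1 hr hrm hsum (fun b hb => by
        by_contra h; exact hbig ⟨b, hb, by omega⟩)

/-! ## Attainment by the most-equal nondecreasing composition -/

/-- ATTAINMENT: `k ≥ 1` blocks of length `q` followed by `r` blocks of length `q+1` give exactly `B5`
(`m = k + r`), for `r = 0` unconditionally and for `r ≥ 1` whenever `(k-1)·v·S_q ≤ u`. -/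
theorem streamV_mostEqual {u v : ℚ} (hu0 : 0 ≤ u) (hu1 : u ≤ 1) (hv0 : 0 ≤ v) {q k r : ℕ} (hk : 1 ≤ k)
    (hatt : r = 0 ∨ ((k : ℚ) - 1) * v * bval u q ≤ u) :
    streamV u v (List.replicate k q ++ List.replicate r (q + 1)) = B5 u v q r (k + r) := by
  obtain ⟨k', rfl⟩ : ∃ k', k = k' + 1 := ⟨k - 1, by omega⟩
  have hS0 : 0 ≤ bval u q := bval_nonneg hu0 hu1 q
  rw [List.replicate_succ, List.cons_append, streamV_cons hu0 hu1, List.map_append, List.map_replicate,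
    List.map_replicate, sfold_append, sfold_replicate hv0 hS0 k' le_rfl]
  rcases Nat.eq_zero_or_pos r with hr | hr
  · subst hr
    unfold B5 bval; simp only [List.replicate_zero, sfold_nil, if_true]; push_cast; ring
  · obtain ⟨r', rfl⟩ : ∃ r', r = r' + 1 := ⟨r - 1, by omega⟩
    have hatt' : ((k' : ℚ) + 1 - 1) * v * bval u q ≤ u := by
      rcases hatt with h | h
      · omega
      · push_cast at h; exact h
    have hX : bval u q + (k' : ℚ) * (v * bval u q) ≤ bval u (q + 1) := by
      unfold bval at hatt' ⊢; push_cast; nlinarith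
    have hS'0 : 0 ≤ bval u (q + 1) := bval_nonneg hu0 hu1 (q + 1)
    have hX0 : 0 ≤ bval u q + (k' : ℚ) * (v * bval u q) := by
      have : (0 : ℚ) ≤ k' := by exact_mod_cast Nat.zero_le k'
      nlinarith [mul_nonneg hv0 hS0]
    rw [List.replicate_succ, sfold_cons, comb_of_ge hX,
      sfold_replicate hv0 hS'0 r' (by nlinarith [mul_nonneg hv0 hX0])]
    unfold B5 bval; rw [if_neg (by omega)]; push_cast; ring

/-- The condition of `B5_le_streamV` implies the attainment condition (with `k = m - r`, `r < m`). -/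
theorem att_of_cond {u v : ℚ} (hu0 : 0 ≤ u) (hu1 : u ≤ 1) (hv0 : 0 ≤ v) {q r m : ℕ} (hrm : r < m)
    (hcond : ((m : ℚ) - 1) * (1 + (q : ℚ) * u) * v ≤ u) :
    (((m - r : ℕ) : ℚ) - 1) * v * bval u q ≤ u := by
  have h1 : ((m - r : ℕ) : ℚ) ≤ m := by exact_mod_cast Nat.sub_le m r
  have h2 : (1 : ℚ) ≤ ((m - r : ℕ) : ℚ) := by exact_mod_cast (show 1 ≤ m - r by omega)
  have hq0 : (0 : ℚ) ≤ q := by exact_mod_cast Nat.zero_le q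
  have hS : bval u q ≤ 1 + (q : ℚ) * u := by unfold bval; nlinarith
  have hS0 : 0 ≤ bval u q := bval_nonneg hu0 hu1 q
  calc (((m - r : ℕ) : ℚ) - 1) * v * bval u q ≤ ((m : ℚ) - 1) * v * (1 + (q : ℚ) * u) := by
        apply mul_le_mul _ hS hS0 (mul_nonneg (by linarith) hv0)
        exact mul_le_mul_of_nonneg_right (by linarith) hv0
    _ = ((m : ℚ) - 1) * (1 + (q : ℚ) * u) * v := by ring
    _ ≤ u := hcond

/-! ## The streaming design is a two-level design of Theorem T5 -/

/-- Fold further sequential narrow blocks (precision label `plo`) onto the design `acc`. -/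
def streamFrom (plo : ℕ) (acc : DTree) : List ℕ → DTree
  | [] => acc
  | b :: rest => streamFrom plo (DTree.node acc (DTree.blk (ofSum plo (seqTree b)))) rest

/-- The STREAMING DESIGN of the block lengths `b₁, …, b_m`: sequential narrow blocks folded left to right
into one wide register (`[]` is sent to a single leaf). -/
def streamDesign (plo : ℕ) : List ℕ → DTree
  | [] => DTree.blk (PTree.leaf 0)
  | b :: rest => streamFrom plo (DTree.blk (ofSum plo (seqTree b))) rest

/-- The outer weight of `streamFrom acc rest` is the streaming fold of the block values onto `outerW acc`. -/
theorem outerW_streamFrom (U : ℕ → ℚ) (v : ℚ) (plo : ℕ) (hU : 0 ≤ U plo) :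
    ∀ (rest : List ℕ) (acc : DTree), (∀ b ∈ rest, 1 ≤ b) →
    outerW U v (streamFrom plo acc rest) = sfold v (outerW U v acc) (rest.map (bval (U plo)))
  | [], _, _ => by simp [streamFrom]
  | b :: rest, acc, h => by
      have hb : 1 ≤ b := h b (by simp)
      rw [streamFrom, outerW_streamFrom U v plo hU rest _ (fun c hc => h c (by simp [hc])), List.map_cons,
        sfold_cons]
      congr 1
      simp only [outerW, treeMP_ofSum, treeM_seqTree hU b hb, bval]

/-- `streamFrom acc rest` has `nblocks acc + rest.length` blocks. -/
theorem nblocks_streamFrom (plo : ℕ) : ∀ (rest : List ℕ) (acc : DTree),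
    nblocks (streamFrom plo acc rest) = nblocks acc + rest.length
  | [], _ => by simp [streamFrom]
  | b :: rest, acc => by
      rw [streamFrom, nblocks_streamFrom plo rest]
      simp [nblocks, shape, leaves]; omega

/-- A block predicate that holds on `acc` and on every appended sequential block holds on `streamFrom acc rest`. -/
theorem blocks_streamFrom (plo : ℕ) (Q : PTree → Prop) : ∀ (rest : List ℕ) (acc : DTree),
    Blocks Q acc → (∀ b ∈ rest, Q (ofSum plo (seqTree b))) → Blocks Q (streamFrom plo acc rest)
  | [], _, h, _ => h
  | b :: rest, acc, h, hr => blocks_streamFrom plo Q rest _ ⟨h, hr b (by simp)⟩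
      (fun c hc => hr c (by simp [hc]))

/-- T5 ↔ T6 DICTIONARY: the node-weighted tree polynomial of the streaming design is the streaming fold. -/
theorem treeMP_streamDesign (U : ℕ → ℚ) (hU : ∀ p, 0 ≤ U p) (hU1 : ∀ p, U p ≤ 1) (plo phi : ℕ)
    {blocks : List ℕ} (hne : blocks ≠ []) (hpos : ∀ b ∈ blocks, 1 ≤ b) :
    treeMP U (toPTree phi (streamDesign plo blocks)) = streamV (U plo) (U phi) blocks := by
  obtain ⟨b, rest, rfl⟩ := List.exists_cons_of_ne_nil hne
  rw [treeMP_toPTree, streamDesign, outerW_streamFrom U (U phi) plo (hU plo) rest _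
      (fun c hc => hpos c (by simp [hc])), streamV_cons (hU plo) (hU1 plo)]
  congr 1
  simp only [outerW, treeMP_ofSum, treeM_seqTree (hU plo) b (hpos b (by simp)), bval]

/-- The streaming design has `m` blocks, all labelled `plo`, of the prescribed lengths. -/
theorem streamDesign_blocks (plo : ℕ) {blocks : List ℕ} (hne : blocks ≠ []) (hpos : ∀ b ∈ blocks, 1 ≤ b) :
    nblocks (streamDesign plo blocks) = blocks.length ∧ Blocks (AllLabels plo) (streamDesign plo blocks) := by
  obtain ⟨b, rest, rfl⟩ := List.exists_cons_of_ne_nil hne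
  refine ⟨?_, ?_⟩
  · rw [streamDesign, nblocks_streamFrom]; simp [nblocks, shape, leaves]; omega
  · exact blocks_streamFrom plo _ rest _ (allLabels_ofSum plo _) (fun c _ => allLabels_ofSum plo _)

/-- ONE PRECISION (`u = v`, cost model CM-T with two registers): the tree polynomial of the blocked
streaming tree `streamTree` (`OptRegisters`) is the streaming fold `streamV u u`. -/
theorem treeM_streamTreeFrom {u : ℚ} (hu0 : 0 ≤ u) : ∀ (rest : List ℕ) (acc : SumTree), (∀ b ∈ rest, 1 ≤ b) →
    treeM u (streamTreeFrom acc rest) = sfold u (treeM u acc) (rest.map (bval u))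
  | [], _, _ => by simp [streamTreeFrom]
  | b :: rest, acc, h => by
      rw [streamTreeFrom, treeM_streamTreeFrom hu0 rest _ (fun c hc => h c (by simp [hc])), List.map_cons,
        sfold_cons, treeM_node, treeM_seqTree hu0 b (h b (by simp))]
      rfl

/-- `M(streamTree blocks)(u) = streamV u u blocks` for nonempty positive blocks. -/
theorem treeM_streamTree {u : ℚ} (hu0 : 0 ≤ u) (hu1 : u ≤ 1) {blocks : List ℕ} (hne : blocks ≠ [])
    (hpos : ∀ b ∈ blocks, 1 ≤ b) : treeM u (streamTree blocks) = streamV u u blocks := by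
  obtain ⟨b, rest, rfl⟩ := List.exists_cons_of_ne_nil hne
  rw [streamTree, treeM_streamTreeFrom hu0 rest _ (fun c hc => hpos c (by simp [hc])),
    treeM_seqTree hu0 b (hpos b (by simp)), streamV_cons hu0 hu1]
  rfl

/-! ## Erratum witness and Statement-level summary -/

/-- ERRATUM to T5(e)/D2 (generation 5): with `u = 2⁻⁴`, `v = 2⁻⁸`, `n = 74 = 4·15 + 14`, `m = 15` the
OLD condition `(m-1)·v ≤ u` holds, but the composition `(4,4,5,…,5,6)` has a smaller streaming polynomial
than `B5` (= the value of the most-equal composition `(4,5,…,5)`): the closed form is NOT the optimum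
there.  (The corrected condition `(m-1)(1+qu)v ≤ u` fails: `14·(1+4/16)/256 = 17.5/256 > 16/256`.) -/
theorem erratum_T5e_D2 :
    ((15 : ℚ) - 1) * (1 / 256) ≤ 1 / 16 ∧
    ¬ (((15 : ℚ) - 1) * (1 + (4 : ℚ) * (1 / 16)) * (1 / 256) ≤ 1 / 16) ∧
    ([4,4,5,5,5,5,5,5,5,5,5,5,5,5,6] : List ℕ).length = 15 ∧
    ([4,4,5,5,5,5,5,5,5,5,5,5,5,5,6] : List ℕ).sum = 4 * 15 + 14 ∧
    streamV (1 / 16) (1 / 256) [4,4,5,5,5,5,5,5,5,5,5,5,5,5,6] = 353693459 / 268435456 ∧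
    B5 (1 / 16) (1 / 256) 4 14 15 = 5399 / 4096 ∧
    (353693459 : ℚ) / 268435456 < 5399 / 4096 := by
  refine ⟨by norm_num, by norm_num, rfl, rfl, ?_, ?_, by norm_num⟩
  · decide +kernel
  · unfold B5; norm_num

/-- R4 (Opt, CM-B family D2, Theorem T6): STREAMING TWO-PRECISION SUMMATION.  Notation: `u_p = 2^-p`
(`unitRoundoff`), narrow precision `plo`, wide precision `phi`, block lengths `blocks` (all `≥ 1`),
`m = |blocks|`, `n = Σ blocks = q·m + r` with `0 ≤ r < m`.
(i) DICTIONARY: the node-weighted tree polynomial (T5) of the streaming design equals `streamV`;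
(ii) SORTING: nondecreasing block order minimises `streamV` for every multiset of blocks;
(iii) OPTIMUM: if `(m-1)(1 + q·u_lo)·u_hi ≤ u_lo` then `streamV ≥ B5(u_lo,u_hi; q,r,m)` for every
composition, and the most-equal nondecreasing composition attains `B5` — so, with T5
(`R4_MixedTreePolyUnderestimation`/`Sharp`), the least possible worst-case relative under-estimation of
a streaming scheme with `m - 1` wide additions on `n` nonnegative numbers is exactly `1 - 1/B5`;
(iv) with no side condition, every composition whose blocks are all `≤ q+1` has `streamV ≥ B5` (`r ≥ 1`);
(v) one precision (`plo = phi`, two registers, CM-T): the tree polynomial of the blocked streaming tree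
`streamTree` is `streamV u u`, so (ii)–(iv) price blocked recursive summation exactly. -/
def R4_StreamingOptimum : Prop :=
  (∀ (plo phi : ℕ) (blocks : List ℕ), blocks ≠ [] → (∀ b ∈ blocks, 1 ≤ b) →
      treeMP (fun p => unitRoundoff p) (toPTree phi (streamDesign plo blocks))
        = streamV (unitRoundoff plo) (unitRoundoff phi) blocks) ∧
  (∀ (p : ℕ) (blocks : List ℕ), blocks ≠ [] → (∀ b ∈ blocks, 1 ≤ b) →
      treeM (unitRoundoff p) (streamTree blocks) = streamV (unitRoundoff p) (unitRoundoff p) blocks) ∧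
  (∀ (plo phi : ℕ) (blocks : List ℕ),
      streamV (unitRoundoff plo) (unitRoundoff phi) (blocks.insertionSort (· ≤ ·))
        ≤ streamV (unitRoundoff plo) (unitRoundoff phi) blocks) ∧
  (∀ (plo phi q r : ℕ) (blocks : List ℕ), 1 ≤ q → r < blocks.length →
      blocks.sum = q * blocks.length + r →
      ((blocks.length : ℚ) - 1) * (1 + (q : ℚ) * unitRoundoff plo) * unitRoundoff phi ≤ unitRoundoff plo →
      B5 (unitRoundoff plo) (unitRoundoff phi) q r blocks.length
        ≤ streamV (unitRoundoff plo) (unitRoundoff phi) blocks ∧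
      streamV (unitRoundoff plo) (unitRoundoff phi)
          (List.replicate (blocks.length - r) q ++ List.replicate r (q + 1))
        = B5 (unitRoundoff plo) (unitRoundoff phi) q r blocks.length) ∧
  (∀ (plo phi q r : ℕ) (blocks : List ℕ), 1 ≤ r → r < blocks.length →
      blocks.sum = q * blocks.length + r → (∀ b ∈ blocks, b ≤ q + 1) →
      B5 (unitRoundoff plo) (unitRoundoff phi) q r blocks.length
        ≤ streamV (unitRoundoff plo) (unitRoundoff phi) blocks)

/-- `R4_StreamingOptimum` holds. -/
theorem R4_StreamingOptimum_holds : R4_StreamingOptimum := by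
  refine ⟨fun plo phi blocks hne hpos => treeMP_streamDesign _ unitRoundoff_nonneg unitRoundoff_le_one
      plo phi hne hpos,
    fun p blocks hne hpos => treeM_streamTree (unitRoundoff_nonneg p) (unitRoundoff_le_one p) hne hpos,
    fun plo phi blocks => streamV_insertionSort_le (unitRoundoff_nonneg plo) (unitRoundoff_le_one plo)
      (unitRoundoff_nonneg phi) (unitRoundoff_le_one phi) blocks,
    fun plo phi q r blocks hq hrm hsum hcond => ⟨?_, ?_⟩,
    fun plo phi q r blocks hr hrm hsum hle => B5_le_streamV_of_le_succ (unitRoundoff_nonneg plo)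
      (unitRoundoff_le_one plo) (unitRoundoff_nonneg phi) (unitRoundoff_le_one phi) hr hrm hsum hle⟩
  · exact B5_le_streamV (unitRoundoff_nonneg plo) (unitRoundoff_le_one plo) (unitRoundoff_nonneg phi)
      (unitRoundoff_le_one phi) hq hrm hsum hcond
  · have h := streamV_mostEqual (unitRoundoff_nonneg plo) (unitRoundoff_le_one plo) (unitRoundoff_nonneg phi)
      (q := q) (r := r) (k := blocks.length - r) (by omega)
      (Or.inr (att_of_cond (unitRoundoff_nonneg plo) (unitRoundoff_le_one plo) (unitRoundoff_nonneg phi) hrm hcond))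
    rwa [Nat.sub_add_cancel (le_of_lt hrm)] at h

end Summit.Ventures.CertifiedArithmetic.LowPrec.Opt
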